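import Mathlib
import Summits.Ventures.PercRepro2.Defs
import Summits.Ventures.PercRepro2.Graph
import Summits.Ventures.PercRepro2.Induced
import Summits.Ventures.PercRepro2.VdBKahn
import Summits.Ventures.PercRepro2.ReimerVdBK
import Summits.Ventures.PercRepro2.ReimerVdBKRegions

/-!
# The component flip: moving a closed part of the world-2-private region to world 1
(blind cell PercRepro2, mine-c g44; `conjectures/MINE-C.md` §53.2 (iii), §53.4)

`flipAt D ω` recolours every edge TOUCHING the vertex set `D`.  If `D` lies in the world-2-private
region `K₂ \ K₁` and is CLOSED there (no edge from `D` to `(K₂ \ K₁) \ D`; e.g. a union of components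
of the graph induced on `K₂ \ K₁`), then the flip makes `D` part of world 1 and removes it from world 2:

  `K₁ (flipAt D ω) = K₁ ω ∪ D`   and   `K₂ (flipAt D ω) ⊆ K₂ ω \ D`

(`K₁_flipAt`, `K₂_flipAt_subset`).  Consequently (`flipAt_mem_twoWorld`): if `ω` lies in the left event
`L = twoWorld A X B Y` of the conjecture `(R-1.2)` and `D` contains every vertex of `B ∪ X` that lies in
`K₂ \ K₁`, then `flipAt D ω` lies in the right event `R = twoWorld (A ∪ B) (X ∩ Y) ∅ (X ∪ Y)` — the
component flip of `MINE-C.md` §53.2 (iii) maps `L` INTO `R` (it is not injective in general; on the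
trivial-core stratum `K₁ ∩ K₂ = {s}` it is, §53.4).  The proofs are closure arguments
(`mem_of_conn_of_closed`) in the two worlds of `ω` and of `flipAt D ω`.
-/

namespace Summit.Ventures.PercRepro2

namespace ReimerVdBK

open Classical

variable {V : Type*} {E : Type*} [Fintype E] [DecidableEq E] [Fintype V] [DecidableEq V]

variable (ends : E → Sym2 V) (s : V)

/-! ## The flip at a vertex set -/

/-- Recolour every edge touching `D`. -/
noncomputable def flipAt (D : Set V) (ω : Config E) : Config E :=
  fun e => if e ∈ touches ends D then !ω e else ω e

omit [Fintype E] [DecidableEq E] [Fintype V] [DecidableEq V] in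
/-- An edge touching `D` is flipped. -/
lemma flipAt_of_mem {D : Set V} {ω : Config E} {e : E} (he : e ∈ touches ends D) :
    flipAt ends D ω e = !ω e := by
  simp [flipAt, he]

omit [Fintype E] [DecidableEq E] [Fintype V] [DecidableEq V] in
/-- An edge not touching `D` keeps its colour. -/
lemma flipAt_of_not_mem {D : Set V} {ω : Config E} {e : E} (he : e ∉ touches ends D) :
    flipAt ends D ω e = ω e := by
  simp [flipAt, he]

omit [Fintype E] [DecidableEq E] [Fintype V] [DecidableEq V] in
/-- If an edge `{x, y}` touches `D` and `x ∉ D`, then `y ∈ D`. -/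
lemma mem_of_touches_of_not_mem {D : Set V} {e : E} {x y : V} (he : e ∈ touches ends D)
    (hends : ends e = s(x, y)) (hx : x ∉ D) : y ∈ D := by
  obtain ⟨z, hz, w, hzw⟩ := he
  rw [hends, Sym2.eq_iff] at hzw
  rcases hzw with ⟨rfl, _⟩ | ⟨_, rfl⟩
  · exact absurd hz hx
  · exact hz

/-! ## The clusters after the flip -/

section Flip

variable {ω : Config E} {D : Set V}

omit [Fintype E] [DecidableEq E] [Fintype V] [DecidableEq V] in
/-- A vertex of `D` is not in world 1 (`D ⊆ K₂ \ K₁`). -/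
lemma not_mem_K₁_of_mem_D (hD : D ⊆ only2 ends s ω) {v : V} (hv : v ∈ D) : v ∉ K₁ ends s ω :=
  ((mem_only2 ends s).1 (hD hv)).2

omit [Fintype E] [DecidableEq E] [Fintype V] [DecidableEq V] in
/-- A vertex of `D` is in world 2 (`D ⊆ K₂ \ K₁`). -/
lemma mem_K₂_of_mem_D (hD : D ⊆ only2 ends s ω) {v : V} (hv : v ∈ D) : v ∈ K₂ ends s ω :=
  ((mem_only2 ends s).1 (hD hv)).1

omit [Fintype E] [DecidableEq E] [Fintype V] [DecidableEq V] in
/-- **World 1 keeps everything**: `K₁ ω ⊆ K₁ (flipAt D ω)` when `D ⊆ K₂ \ K₁`. -/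
lemma K₁_subset_K₁_flipAt (hD : D ⊆ only2 ends s ω) :
    K₁ ends s ω ⊆ K₁ ends s (flipAt ends D ω) := by
  -- the set `K₁ ω ∩ K₁ (flip)` is closed under open adjacency in `ω`
  have hclosed : ∀ x ∈ K₁ ends s ω ∩ K₁ ends s (flipAt ends D ω), ∀ y,
      (openGraph ends ω).Adj x y → y ∈ K₁ ends s ω ∩ K₁ ends s (flipAt ends D ω) := by
    rintro x ⟨hx1, hx2⟩ y hxy
    obtain ⟨-, e, he, hends⟩ := openGraph_adj.1 hxy
    have hy1 : y ∈ K₁ ends s ω := mem_K₁_of_open ends s hx1 he hends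
    refine ⟨hy1, ?_⟩
    by_cases ht : e ∈ touches ends D
    · -- the edge touches `D`: its other endpoint would lie in `D`, outside world 1
      have hxD : x ∉ D := fun h => not_mem_K₁_of_mem_D ends s hD h hx1
      have hyD : y ∈ D := mem_of_touches_of_not_mem ends ht hends hxD
      exact absurd hy1 (not_mem_K₁_of_mem_D ends s hD hyD)
    · have he' : flipAt ends D ω e = true := by rw [flipAt_of_not_mem ends ht]; exact he
      exact mem_K₁_of_open ends s hx2 he' hends
  intro v hv
  exact (mem_of_conn_of_closed hclosed ⟨root_mem_K₁ ends s ω, root_mem_K₁ ends s _⟩ hv).2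

omit [Fintype E] [DecidableEq E] [Fintype V] [DecidableEq V] in
/-- **The flipped part joins world 1**: `D ⊆ K₁ (flipAt D ω)` when `D ⊆ K₂ \ K₁` is closed in `K₂ \ K₁`. -/
lemma D_subset_K₁_flipAt (hD : D ⊆ only2 ends s ω)
    (hcl : ∀ e x y, ends e = s(x, y) → x ∈ D → y ∉ D → y ∉ only2 ends s ω) :
    D ⊆ K₁ ends s (flipAt ends D ω) := by
  -- the set `(K₂ ω \ D) ∪ (D ∩ K₁ (flip))` is closed under open adjacency in world 2 of `ω`
  set T : Set V := (K₂ ends s ω \ D) ∪ (D ∩ K₁ ends s (flipAt ends D ω)) with hT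
  have hK₁ := K₁_subset_K₁_flipAt ends s hD
  have hclosed : ∀ x ∈ T, ∀ y, (openGraph ends (compl ω)).Adj x y → y ∈ T := by
    intro x hx y hxy
    obtain ⟨-, e, he, hends⟩ := openGraph_adj.1 hxy
    have he0 : ω e = false := by simpa [compl] using he
    have hx2 : x ∈ K₂ ends s ω := by
      rcases hx with hx | hx
      · exact hx.1
      · exact mem_K₂_of_mem_D ends s hD hx.1
    have hy2 : y ∈ K₂ ends s ω := mem_K₂_of_closed ends s hx2 he0 hends
    by_cases hyD : y ∈ D
    · -- the edge touches `D`, so it is red after the flip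
      have ht : e ∈ touches ends D := mem_touches_of_ends hends (Or.inr hyD)
      have he' : flipAt ends D ω e = true := by rw [flipAt_of_mem ends ht, he0]; rfl
      refine Or.inr ⟨hyD, ?_⟩
      rcases hx with hx | hx
      · -- `x ∈ K₂ \ D` is adjacent to `D` through `e`: by closedness it lies in world 1
        have hx1 : x ∈ K₁ ends s ω := by
          have hno := hcl e y x (by rw [hends, Sym2.eq_swap]) hyD hx.2
          by_contra hx1
          exact hno ((mem_only2 ends s).2 ⟨hx.1, hx1⟩)
        exact mem_K₁_of_open ends s (hK₁ hx1) he' hends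
      · exact mem_K₁_of_open ends s hx.2 he' hends
    · exact Or.inl ⟨hy2, hyD⟩
  have hsT : s ∈ T := Or.inl ⟨root_mem_K₂ ends s ω, fun h => not_mem_K₁_of_mem_D ends s hD h (root_mem_K₁ ends s ω)⟩
  intro v hv
  have hv2 : v ∈ K₂ ends s ω := mem_K₂_of_mem_D ends s hD hv
  have hvT : v ∈ T := mem_of_conn_of_closed hclosed hsT hv2
  rcases hvT with h | h
  · exact absurd hv h.2
  · exact h.2

omit [Fintype E] [DecidableEq E] [Fintype V] [DecidableEq V] in
/-- **World 1 gains exactly the flipped part**: `K₁ (flipAt D ω) = K₁ ω ∪ D`. -/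
theorem K₁_flipAt (hD : D ⊆ only2 ends s ω)
    (hcl : ∀ e x y, ends e = s(x, y) → x ∈ D → y ∉ D → y ∉ only2 ends s ω) :
    K₁ ends s (flipAt ends D ω) = K₁ ends s ω ∪ D := by
  apply Set.Subset.antisymm
  · -- `K₁ ω ∪ D` is closed under open adjacency in `flipAt D ω`
    have hclosed : ∀ x ∈ K₁ ends s ω ∪ D, ∀ y,
        (openGraph ends (flipAt ends D ω)).Adj x y → y ∈ K₁ ends s ω ∪ D := by
      intro x hx y hxy
      obtain ⟨-, e, he, hends⟩ := openGraph_adj.1 hxy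
      by_cases hyD : y ∈ D
      · exact Or.inr hyD
      rcases hx with hx | hx
      · by_cases ht : e ∈ touches ends D
        · exact absurd (mem_of_touches_of_not_mem ends ht hends
            (fun h => not_mem_K₁_of_mem_D ends s hD h hx)) hyD
        · have he' : ω e = true := by rw [← flipAt_of_not_mem ends (ω := ω) ht]; exact he
          exact Or.inl (mem_K₁_of_open ends s hx he' hends)
      · -- `x ∈ D`, `y ∉ D`: the edge touches `D`, it was blue, so `y ∈ K₂`, hence `y ∈ K₁` by closedness
        have ht : e ∈ touches ends D := mem_touches_of_ends hends (Or.inl hx)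
        have he0 : ω e = false := by
          have := flipAt_of_mem ends (ω := ω) ht
          rw [he] at this
          cases h : ω e
          · rfl
          · rw [h] at this; exact absurd this (by decide)
        have hy2 : y ∈ K₂ ends s ω := mem_K₂_of_closed ends s (mem_K₂_of_mem_D ends s hD hx) he0 hends
        have hno := hcl e x y hends hx hyD
        by_contra hy1
        exact hno ((mem_only2 ends s).2 ⟨hy2, fun h => hy1 (Or.inl h)⟩)
    intro v hv
    exact mem_of_conn_of_closed hclosed (Or.inl (root_mem_K₁ ends s ω)) hv
  · exact Set.union_subset (K₁_subset_K₁_flipAt ends s hD) (D_subset_K₁_flipAt ends s hD hcl)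

omit [Fintype E] [DecidableEq E] [Fintype V] [DecidableEq V] in
/-- **World 2 loses the flipped part and gains nothing**: `K₂ (flipAt D ω) ⊆ K₂ ω \ D`. -/
theorem K₂_flipAt_subset (hD : D ⊆ only2 ends s ω)
    (hcl : ∀ e x y, ends e = s(x, y) → x ∈ D → y ∉ D → y ∉ only2 ends s ω) :
    K₂ ends s (flipAt ends D ω) ⊆ K₂ ends s ω \ D := by
  -- `K₂ ω \ D` is closed under open adjacency in world 2 of `flipAt D ω`
  have hclosed : ∀ x ∈ K₂ ends s ω \ D, ∀ y,
      (openGraph ends (compl (flipAt ends D ω))).Adj x y → y ∈ K₂ ends s ω \ D := by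
    rintro x ⟨hx2, hxD⟩ y hxy
    obtain ⟨-, e, he, hends⟩ := openGraph_adj.1 hxy
    have he0 : flipAt ends D ω e = false := by simpa [compl] using he
    by_cases ht : e ∈ touches ends D
    · -- the edge touches `D` at `y`; it was red (`x ∈ K₁` by closedness), so `y ∈ K₁`: impossible
      have hyD : y ∈ D := mem_of_touches_of_not_mem ends ht hends hxD
      have he1 : ω e = true := by
        have := flipAt_of_mem ends (ω := ω) ht
        rw [he0] at this
        cases h : ω e
        · rw [h] at this; exact absurd this (by decide)
        · rfl
      have hx1 : x ∈ K₁ ends s ω := by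
        have hno := hcl e y x (by rw [hends, Sym2.eq_swap]) hyD hxD
        by_contra hx1
        exact hno ((mem_only2 ends s).2 ⟨hx2, hx1⟩)
      exact absurd (mem_K₁_of_open ends s hx1 he1 hends) (not_mem_K₁_of_mem_D ends s hD hyD)
    · have he0' : ω e = false := by rw [← flipAt_of_not_mem ends (ω := ω) ht]; exact he0
      refine ⟨mem_K₂_of_closed ends s hx2 he0' hends, fun hyD => ht ?_⟩
      exact mem_touches_of_ends hends (Or.inr hyD)
  have hs : s ∈ K₂ ends s ω \ D :=
    ⟨root_mem_K₂ ends s ω, fun h => not_mem_K₁_of_mem_D ends s hD h (root_mem_K₁ ends s ω)⟩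
  intro v hv
  exact mem_of_conn_of_closed hclosed hs hv

end Flip

/-! ## The component flip lands in the right event of (R-1.2) -/

omit [Fintype E] [DecidableEq E] [Fintype V] in
/-- **The component flip maps `L` into `R`**: if `ω ∈ twoWorld A X B Y`, `D ⊆ K₂ \ K₁` is closed in
`K₂ \ K₁` and contains every vertex of `B ∪ X` lying in `K₂ \ K₁`, then
`flipAt D ω ∈ twoWorld (A ∪ B) (X ∩ Y) ∅ (X ∪ Y)`. -/
theorem flipAt_mem_twoWorld {A X B Y : Finset V} {ω : Config E} {D : Set V}
    (hω : ω ∈ twoWorld ends s A X B Y) (hD : D ⊆ only2 ends s ω)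
    (hcl : ∀ e x y, ends e = s(x, y) → x ∈ D → y ∉ D → y ∉ only2 ends s ω)
    (hBX : ∀ v ∈ B ∪ X, v ∈ only2 ends s ω → v ∈ D) :
    flipAt ends D ω ∈ twoWorld ends s (A ∪ B) (X ∩ Y) ∅ (X ∪ Y) := by
  rw [mem_twoWorld_iff] at hω ⊢
  obtain ⟨hA, hX, hB, hY⟩ := hω
  have h1 := K₁_flipAt ends s hD hcl
  have h2 := K₂_flipAt_subset ends s hD hcl
  refine ⟨?_, ?_, ?_, ?_⟩
  · intro v hv
    rw [h1]
    rcases Finset.mem_union.1 hv with hv | hv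
    · exact Or.inl (hA v hv)
    · by_cases hv1 : v ∈ K₁ ends s ω
      · exact Or.inl hv1
      · exact Or.inr (hBX v (Finset.mem_union_left X hv) ((mem_only2 ends s).2 ⟨hB v hv, hv1⟩))
  · intro v hv
    rw [h1]
    rintro (hv1 | hvD)
    · exact hX v (Finset.mem_inter.1 hv).1 hv1
    · exact hY v (Finset.mem_inter.1 hv).2 (mem_K₂_of_mem_D ends s hD hvD)
  · intro v hv
    exact absurd hv (Finset.notMem_empty v)
  · intro v hv hv2
    have hv2' := h2 hv2
    rcases Finset.mem_union.1 hv with hv | hv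
    · by_cases hv1 : v ∈ K₁ ends s ω
      · exact hX v hv hv1
      · exact hv2'.2 (hBX v (Finset.mem_union_right B hv) ((mem_only2 ends s).2 ⟨hv2'.1, hv1⟩))
    · exact hY v hv hv2'.1

end ReimerVdBK

end Summit.Ventures.PercRepro2
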